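import Summits.ResolutionOfSingularities.ResolutionOfSingularities.Theorems.WildPurityPurityTransferStubFormsSpan
import Summits.ResolutionOfSingularities.ResolutionOfSingularities.Theorems.WildPurityPurityTransferStubBkForward
import Summits.ResolutionOfSingularities.ResolutionOfSingularities.Theorems.WildPurityPurityTransferStubBkDescends
import Summits.ResolutionOfSingularities.ResolutionOfSingularities.Theorems.WildPurityPurityTransferStubBkAssemble
import Literature.NumberTheory.GaloisCohomology.BlochKatoFormsSymbol
import HarnessLib

/-!
# The named fact `BlochKato1986_symbolicPresentation` is a THEOREM
# (crux `WildPurity.PurityTransfer`, stmt-ResolutionOfSingularities-17142, line `birth`, lead c1)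

Discharge of the tree's named fact
`Literature.NumberTheory.GaloisCohomology.BlochKato1986_symbolicPresentation`
(`KatoCohomologyDifferentialForms.lean`): for every `p` prime and every field `K` of characteristic `p`,
Kato's symbolic group `KatoCohomologySymbolic p K n` (generators `[a, b₁, …, bₙ}`) is isomorphic to
`KatoCohomologyDeRham p K n = Ωⁿ_K ⧸ (dΩⁿ⁻¹_K + ⟨(a^p − a) dlog b⟩)` by `[a, b} ↦ a · dlog b₁ ∧ ⋯ ∧ dlog bₙ`
— Bloch–Kato 1986, Lemma (4.2) ("Straightforward and left to the reader"), assembled from the landed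
stubs of the lead's skeleton rev L4:

* `stub_formsSpan` (p163554) — the `dlogForm K b` span `Ωⁿ_K` (surjectivity of `δ`);
* `stub_bkForward` (p163789) — `δ` exists on the symbolic group (relation (4) = exactness of
  `bᵢ • dlogForm K b`);
* `stub_bkDescends` (p164190) — an inverse on forms kills `dΩⁿ⁻¹ ⊔ AS`;
* `stub_bkAssemble` (p164347) — the two maps are mutually inverse;
* the inverse on forms itself: `BlochKatoForms.exists_addMonoidHom_forms_symbol`
  (`Literature/NumberTheory/GaloisCohomology/BlochKatoForms.lean` p164219 — the presentation module and
  the alternating comparison map `Ωⁿ_K → BlochKatoForms K n` — and `…/BlochKatoFormsSymbol.lean`).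

With this, the crux's remaining dependency is Gros–Suwa purity ON DIFFERENTIAL FORMS only
(`stub_purityTransport`, p163682, transports it to the symbolic `GrosSuwa1988_purity`).
-/

set_option linter.dupNamespace false

noncomputable section

universe u

open Literature.NumberTheory.GaloisCohomology

namespace Summit.ResolutionOfSingularities.ResolutionOfSingularities.Theorems.WildPurityPurityTransfer

/-- **Bloch–Kato 1986, Lemma (4.2), for fields: the symbolic presentation of Kato's `H^{n+1}_p(K)`** —
the named fact `BlochKato1986_symbolicPresentation` holds: for `p` prime and `K` a field of characteristic
`p`, there is an additive isomorphism `KatoCohomologySymbolic p K n ≃+ KatoCohomologyDeRham p K n` sending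
`[a, b}` to the class of `a · dlog b₀ ∧ ⋯ ∧ dlog b_{n-1}`.  Proof: `stub_bkAssemble` applied to
`stub_formsSpan`, `stub_bkForward`, `BlochKatoForms.exists_addMonoidHom_forms_symbol`, `stub_bkDescends`.
[cite: BlochKato1986, Lemma (4.2), p. 122] -/
theorem BlochKato1986_symbolicPresentation_holds : BlochKato1986_symbolicPresentation.{u} :=
  stub_bkAssemble.{u} stub_formsSpan.{u} stub_bkForward.{u}
    (fun p _ K _ _ _ => BlochKatoForms.exists_addMonoidHom_forms_symbol K p) stub_bkDescends.{u}

end Summit.ResolutionOfSingularities.ResolutionOfSingularities.Theorems.WildPurityPurityTransfer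

end
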